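import Literature.AnabelianGeometry.EtaleTheta.XuuCocycleOfProp15
import HarnessLib

/-!
# [EtTh] Prop. 1.5 (ii) over the §1 setting: `F̈²` is ROOT-CLOSED in `H¹((Π^tp_Ÿ)^Θ, Δ_Θ)` (the quotient
# `H¹/F̈²`, hence `F̈¹/F̈²`, is torsion-free) — and the binder `hL` reduces to `log(Ü) ∉ F̈²`

Mochizuki, *The étale theta function and its Frobenioid-theoretic manifestations*, Publ. RIMS **45**
(2009), Prop. 1.5 (ii), PRIMS PDF p. 23: "`F̈¹/F̈² = Hom((Δ^tp_Ÿ)^ell/Δ_Θ, Δ_Θ) = Ẑ · log(Ü)`",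
"`F̈² = H¹(G_K̈, Δ_Θ)`"; §1 p. 12 "`Δ_Θ (≅ Ẑ(1))`" [cite: MochizukiEtTh2009, Prop 1.5 (ii) p.23].

Cell abc-iut, layer L2 (seat abc-iut-L2-t7); self-named support piece for GAP-LEDGER row G-L2t1-1 (the
binder `hL` "`log(Ü)` has infinite order modulo `F̈²`" of seat abc-iut-L2-t1's `Sec1TranslatesNonTorsion` /
row R46 of abc-iut-L2-lead gen 3). PROOF-ONLY (0 definitions). The typed `F̈²` is the kernel of restriction
to `(Δ^tp_Ÿ)^Θ`, a subgroup CENTRALISING `Δ_Θ`, on which continuous `H¹` is `Hom(−, Δ_Θ)` with no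
coboundaries; since `Δ_Θ` is torsion-free under the guard `IsEtThOrigin` (seat abc-iut-L2-t8's
`deltaTheta_torsionfree`), `H¹((Δ^tp_Ÿ)^Θ, Δ_Θ)` is torsion-free and therefore:

* `mem_Fdd2_of_pow_mem_Fdd2` / `mem_Fdd2_of_zpow_mem_Fdd2` — `yⁿ ∈ F̈²`, `n ≠ 0` ⇒ `y ∈ F̈²` (the typed
  shadow of "`F̈¹/F̈² = Hom(…, Δ_Θ)` is torsion-free"; the case `n = 2` is
  `XuuCocycleOfProp15.mem_Fdd2_of_sq_mem_Fdd2`);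
* `logUdd_zpow_mem_Fdd2_imp_of_not_mem` — **the binder `hL` of G-L2t1-1 in EXACTLY its typed shape
  `∀ n : ℤ, log(Ü)ⁿ ∈ F̈² → n = 0` FOLLOWS from the single statement `log(Ü) ∉ F̈²`** ("`log(Ü)` does not
  die on the geometric subgroup `(Δ^tp_Ÿ)^Θ`", the honest residual: `KummerData` with `logUdd := 1`
  satisfies every typed clause, so this last statement is not derivable over the §1 interface).

Nothing of [EtTh] is asserted; typed ≠ endorsed; no side is taken on any disputed claim.
-/

noncomputable section

namespace Literature.AnabelianGeometry.EtaleTheta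

open Literature.AnabelianGeometry.SemiGraphs
open scoped IsMulCommutative

namespace ThetaSetting

variable {p : ℕ} [Fact p.Prime] {D : ThetaSetting p}

/-- **`F̈²` is root-closed**: a class `y ∈ H¹((Π^tp_Ÿ)^Θ, Δ_Θ)` with `yⁿ ∈ F̈²` for some `n ≠ 0` lies in
`F̈²` — `F̈² = Ker(res → H¹((Δ^tp_Ÿ)^Θ, Δ_Θ))`, and `H¹` of the subgroup `(Δ^tp_Ÿ)^Θ` centralising the
torsion-free `Δ_Θ` has no torsion. [cite: MochizukiEtTh2009, Prop 1.5 (ii) p.23] -/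
theorem mem_Fdd2_of_pow_mem_Fdd2 (hO : D.IsEtThOrigin) {y : D.H1Theta (D.GtpYdd.map D.toTheta)}
    {n : ℕ} (hn : n ≠ 0)
    (hy : y ^ n ∈ (Fdd2 : Subgroup (D.H1Theta (D.GtpYdd.map D.toTheta)))) :
    y ∈ (Fdd2 : Subgroup (D.H1Theta (D.GtpYdd.map D.toTheta))) := by
  have hM : (D.DtpYddN 1).map D.toTheta ≤ D.GtpYdd.map D.toTheta := Subgroup.map_mono inf_le_left
  change ContH1.res (MonoidHom.id D.GtpTheta) D.DeltaTheta hM y = 1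
  have hy' : ContH1.res (MonoidHom.id D.GtpTheta) D.DeltaTheta hM (y ^ n) = 1 := hy
  rw [map_pow] at hy'
  refine ContH1.eq_one_of_pow_eq_one_of_centralizes (fun g hg a ha => ?_) (fun a han => ?_) _ hy'
  · rw [MonoidHom.id_apply]
    exact (D.ker_thetaToEll_central a ha g (Subgroup.map_mono inf_le_right hg)).symm
  · exact Subtype.ext (D.deltaTheta_torsionfree hO a.2 hn (by
      have := congrArg Subtype.val han; simpa using this))

/-- The same for integer exponents `n ≠ 0`. [cite: MochizukiEtTh2009, Prop 1.5 (ii) p.23] -/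
theorem mem_Fdd2_of_zpow_mem_Fdd2 (hO : D.IsEtThOrigin) {y : D.H1Theta (D.GtpYdd.map D.toTheta)}
    {n : ℤ} (hn : n ≠ 0)
    (hy : y ^ n ∈ (Fdd2 : Subgroup (D.H1Theta (D.GtpYdd.map D.toTheta)))) :
    y ∈ (Fdd2 : Subgroup (D.H1Theta (D.GtpYdd.map D.toTheta))) := by
  obtain ⟨m, rfl | rfl⟩ := n.eq_nat_or_neg
  · rw [zpow_natCast] at hy
    exact mem_Fdd2_of_pow_mem_Fdd2 hO (by exact_mod_cast hn) hy
  · rw [zpow_neg, zpow_natCast] at hy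
    have hy' := inv_mem hy
    rw [inv_inv] at hy'
    exact mem_Fdd2_of_pow_mem_Fdd2 hO (by rintro rfl; exact hn (by simp)) hy'

/-- **The quotient `H¹((Π^tp_Ÿ)^Θ, Δ_Θ)/F̈²` is torsion-free**, stated without quotients: if `y ∉ F̈²` then
no nonzero power of `y` lies in `F̈²`. [cite: MochizukiEtTh2009, Prop 1.5 (ii) p.23] -/
theorem zpow_mem_Fdd2_imp_eq_zero_of_not_mem (hO : D.IsEtThOrigin)
    {y : D.H1Theta (D.GtpYdd.map D.toTheta)}
    (hy : y ∉ (Fdd2 : Subgroup (D.H1Theta (D.GtpYdd.map D.toTheta)))) (n : ℤ)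
    (hn : y ^ n ∈ (Fdd2 : Subgroup (D.H1Theta (D.GtpYdd.map D.toTheta)))) : n = 0 := by
  by_contra h
  exact hy (mem_Fdd2_of_zpow_mem_Fdd2 hO h hn)

namespace KummerData

variable (E : D.KummerData)

/-- **The binder `hL` of GAP-LEDGER G-L2t1-1 reduces to `log(Ü) ∉ F̈²`.** Under the guard
`IsEtThOrigin`, "`log(Ü)` has infinite order modulo `F̈²`" — in exactly the shape
`∀ n : ℤ, log(Ü)ⁿ ∈ F̈² → n = 0` consumed by seat abc-iut-L2-t1's `Sec1TranslatesNonTorsion` — follows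
from the single statement that `log(Ü)` does not restrict to the trivial class on `(Δ^tp_Ÿ)^Θ` (the printed
"`F̈¹/F̈² = Ẑ · log(Ü)`", p. 23, of which this is the honest typeable residue).
[cite: MochizukiEtTh2009, Prop 1.5 (ii) p.23] -/
theorem logUdd_zpow_mem_Fdd2_imp_of_not_mem (hO : D.IsEtThOrigin)
    (hL₀ : E.logUdd ∉ (Fdd2 : Subgroup (D.H1Theta (D.GtpYdd.map D.toTheta)))) :
    ∀ n : ℤ, E.logUdd ^ n ∈ (Fdd2 : Subgroup (D.H1Theta (D.GtpYdd.map D.toTheta))) → n = 0 :=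
  zpow_mem_Fdd2_imp_eq_zero_of_not_mem hO hL₀

end KummerData

end ThetaSetting

end Literature.AnabelianGeometry.EtaleTheta

end
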